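import Literature.AlgebraicGeometry.CossartJannsenSaito2020.KeyTheoremsAPI
import Literature.AlgebraicGeometry.Resolution.BlowupsLocal
import HarnessLib

/-!
# Compressing a tower of blow-ups along its TRIVIAL stages (empty centres = isomorphic blow-ups)
# — bookkeeping for CJS LNM 2270, Def. 6.38 / 6.39 read on a canonical resolution sequence

Source context: V. Cossart, U. Jannsen, S. Saito, *Desingularization: Invariants and Strategy*, LNM **2270** (2020)
[`CossartJannsenSaito2020`], Def. 6.34 (display (6.25)), Def. 6.38, Def. 6.39, Rem. 6.29 (1), p. 107. A fundamental unit
(Def. 6.38) lists ONLY the blow-ups that change the local picture at the marked point; the canonical sequence `S(X, ν)` of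
Rem. 6.29 (1), localised at an isolated point `x` (p. 107, tree `BlowupTower.localize`), interleaves them with blow-ups whose
centre — seen over the generizations of `x` — is EMPTY (steps treating other labels, replays off the fibre): blow-ups of the unit
ideal, i.e. isomorphisms. This file PROVES the fact-free bookkeeping that removes such stages:

* `BlowupTower.isIso_π_of_C_eq_empty` — a stage with empty centre is blown up isomorphically (`vanishingIdeal ⊥ = ⊤`,
  `IsBlowup.isIso`, `isEffectiveCartier_top`).
* `BlowupTower.hop T a d : T.X (a + d + 1) ⟶ T.X (a + 1)` — the composite of the `d` blow-downs above stage `a + 1`;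
  `isIso_hop` when the intermediate centres `C (a + 1), …, C (a + d)` are empty; `phi_comp_hop`.
* `BlowupTower.compress T n₀ gap` — **the compressed tower**: stages `idx 0 = n₀`, `idx (k + 1) = idx k + gap k + 1` of `T`
  (gap-indexed, so every stage identity is definitional — no casts), centres `C (idx k)`, blow-downs `hop ≫ π (idx k)`; it IS a tower
  of blow-ups as soon as every skipped centre is empty (`IsBlowup.iso_comp`). API: `compress_X`, `compress_C`, `compress_idx_*`,
  `hsFun`/`dirDimAt`/`geomDirDimAt` agree definitionally, `compress_phi_base` (the structure maps to `X_{n₀}` agree with `T`'s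
  composites), `nearLocus_compress` (near loci are those of `T.drop n₀` at the kept stages).

[OURS · L1 W4.2] bookkeeping over the tree's `BlowupTower` (`KeyTheorems.lean`) — declared in the `BlowupTower` namespace for dot-notation; nothing about the Key Theorems is asserted; NOT a statement of the manuscript [Hironaka2017] nor of [CossartJannsenSaito2020]. Written for the
units-half «segment extraction» of cell res-hironaka [L W4.2] (res-L1-w42-stub-1). AI-written; AI review is weaker than expert review.

## References
* V. Cossart, U. Jannsen, S. Saito, LNM 2270 (2020), Def. 6.34, Def. 6.38, Def. 6.39, Rem. 6.29 (1), p. 107. [CossartJannsenSaito2020]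
* U. Görtz, T. Wedhorn, *Algebraic Geometry I* (2nd ed.), remark after Def. 13.90 (blowing up a Cartier divisor is an isomorphism).
  [GortzWedhorn2020]
-/

noncomputable section

open CategoryTheory AlgebraicGeometry TopologicalSpace
open Literature.AlgebraicGeometry.Resolution

namespace Literature.AlgebraicGeometry.CossartJannsenSaito2020

universe u

namespace BlowupTower

/-! ## §1. Trivial stages: empty centre ⇒ isomorphic blow-down -/

/-- The ideal of an EMPTY centre is the unit ideal sheaf. [folklore] -/
theorem centreIdeal_eq_top_of_C_eq_empty (T : BlowupTower.{u}) {n : ℕ} (h : T.C n = ∅) : T.centreIdeal n = ⊤ := by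
  have hbot : (⟨T.C n, T.isClosed_C n⟩ : Closeds (T.X n)) = ⊥ := TopologicalSpace.Closeds.ext (by simp [h])
  unfold centreIdeal
  rw [hbot, Scheme.IdealSheafData.vanishingIdeal_bot]

/-- **A stage with empty centre is blown up isomorphically** (the blow-up of the unit ideal; GW, remark after Def. 13.90).
[cite: GortzWedhorn2020, Def. 13.90] -/
theorem isIso_π_of_C_eq_empty (T : BlowupTower.{u}) {n : ℕ} (h : T.C n = ∅) : IsIso (T.π n) :=
  (T.isBlowup n).isIso (by
    show IsEffectiveCartier (T.centreIdeal n)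
    rw [T.centreIdeal_eq_top_of_C_eq_empty h]; exact isEffectiveCartier_top)

/-! ## §2. Composites of consecutive blow-downs -/

/-- `hop T a d : X_{a+d+1} ⟶ X_{a+1}`, the composite `π_{a+1} ∘ ⋯ ∘ π_{a+d}` of the `d` blow-downs above stage `a + 1`
(`hop T a 0 = 𝟙`). Gap-indexed so that source and target are definitional. [folklore] -/
def hop (T : BlowupTower.{u}) (a : ℕ) : (d : ℕ) → (T.X (a + d + 1) ⟶ T.X (a + 1))
  | 0 => 𝟙 _
  | d + 1 => T.π (a + d + 1) ≫ hop T a d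

/-- Unfolding. [folklore] -/
theorem hop_zero (T : BlowupTower.{u}) (a : ℕ) : T.hop a 0 = 𝟙 (T.X (a + 1)) := rfl

/-- Unfolding. [folklore] -/
theorem hop_succ (T : BlowupTower.{u}) (a d : ℕ) : T.hop a (d + 1) = T.π (a + d + 1) ≫ T.hop a d := rfl

/-- **The composite of blow-downs with EMPTY centres is an isomorphism.** [folklore] -/
theorem isIso_hop (T : BlowupTower.{u}) (a : ℕ) : ∀ d : ℕ, (∀ j, j < d → T.C (a + j + 1) = ∅) → IsIso (T.hop a d)
  | 0, _ => by rw [hop_zero]; infer_instance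
  | d + 1, h => by
    rw [hop_succ]
    haveI : IsIso (T.π (a + d + 1)) := T.isIso_π_of_C_eq_empty (h d (Nat.lt_succ_self d))
    haveI : IsIso (T.hop a d) := isIso_hop T a d fun j hj => h j (Nat.lt_succ_of_lt hj)
    infer_instance

/-- `φ_{a+d+1} = hop ≫ φ_{a+1}`: the structure maps to `X_0` factor through the hops. [folklore] -/
theorem hop_comp_phi (T : BlowupTower.{u}) (a : ℕ) : ∀ d : ℕ, T.hop a d ≫ T.phi (a + 1) = T.phi (a + d + 1)
  | 0 => by rw [hop_zero, Category.id_comp]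
  | d + 1 => by
    rw [hop_succ, Category.assoc, hop_comp_phi T a d]
    rfl

/-- Pointwise form of `hop_comp_phi`. [folklore] -/
theorem phi_base_hop (T : BlowupTower.{u}) (a d : ℕ) (ξ : T.X (a + d + 1)) :
    (T.phi (a + 1)).base ((T.hop a d).base ξ) = (T.phi (a + d + 1)).base ξ := by
  rw [← T.hop_comp_phi a d]; rfl

/-! ## §3. The compressed tower -/

/-- The indices of the KEPT stages: `cidx 0 = n₀`, `cidx (k+1) = cidx k + gap k + 1`. [folklore] -/
def cidx (n₀ : ℕ) (gap : ℕ → ℕ) : ℕ → ℕ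
  | 0 => n₀
  | k + 1 => cidx n₀ gap k + gap k + 1

/-- Unfolding. [folklore] -/
@[simp] theorem cidx_zero (n₀ : ℕ) (gap : ℕ → ℕ) : cidx n₀ gap 0 = n₀ := rfl

/-- Unfolding. [folklore] -/
@[simp] theorem cidx_succ (n₀ : ℕ) (gap : ℕ → ℕ) (k : ℕ) : cidx n₀ gap (k + 1) = cidx n₀ gap k + gap k + 1 := rfl

/-- The kept indices increase strictly. [folklore] -/
theorem cidx_lt_succ (n₀ : ℕ) (gap : ℕ → ℕ) (k : ℕ) : cidx n₀ gap k < cidx n₀ gap (k + 1) := by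
  rw [cidx_succ]; omega

/-- The kept indices are strictly monotone. [folklore] -/
theorem cidx_strictMono (n₀ : ℕ) (gap : ℕ → ℕ) : StrictMono (cidx n₀ gap) :=
  strictMono_nat_of_lt_succ (cidx_lt_succ n₀ gap)

/-- The kept indices dominate their rank. [folklore] -/
theorem self_le_cidx (n₀ : ℕ) (gap : ℕ → ℕ) (k : ℕ) : n₀ + k ≤ cidx n₀ gap k := by
  induction k with
  | zero => exact le_rfl
  | succ k ih => rw [cidx_succ]; omega

/-- The compression from `n₀` re-indexes the compression from `0` of the dropped tower: `cidx n₀ gap k = n₀ + cidx 0 gap k`.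
[folklore] -/
theorem cidx_eq_add (n₀ : ℕ) (gap : ℕ → ℕ) (k : ℕ) : cidx n₀ gap k = n₀ + cidx 0 gap k := by
  induction k with
  | zero => simp
  | succ k ih => rw [cidx_succ, cidx_succ, ih]; omega

/-- **THE COMPRESSED TOWER.** Keep the stages `cidx k` of `T` (`cidx 0 = n₀`, `cidx (k+1) = cidx k + gap k + 1`), with their
centres; the blow-down from the `(k+1)`-st kept stage to the `k`-th is the composite of the skipped blow-downs (required to have
EMPTY centres, `htriv`) followed by `π_{cidx k}`. It is a tower of blow-ups by `IsBlowup.iso_comp`.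
[cite: CossartJannsenSaito2020, Def. 6.38, p. 107] -/
@[reducible] def compress (T : BlowupTower.{u}) (n₀ : ℕ) (gap : ℕ → ℕ)
    (htriv : ∀ k j, j < gap k → T.C (cidx n₀ gap k + j + 1) = ∅) : BlowupTower.{u} where
  X k := T.X (cidx n₀ gap k)
  ln k := T.ln (cidx n₀ gap k)
  C k := T.C (cidx n₀ gap k)
  isClosed_C k := T.isClosed_C (cidx n₀ gap k)
  π k := T.hop (cidx n₀ gap k) (gap k) ≫ T.π (cidx n₀ gap k)
  isBlowup k := by
    haveI := T.isIso_hop (cidx n₀ gap k) (gap k) (htriv k)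
    exact (T.isBlowup (cidx n₀ gap k)).iso_comp (asIso (T.hop (cidx n₀ gap k) (gap k)))

variable (T : BlowupTower.{u}) {n₀ : ℕ} {gap : ℕ → ℕ} (htriv : ∀ k j, j < gap k → T.C (cidx n₀ gap k + j + 1) = ∅)

/-- Unfolding: the stages of the compressed tower. [folklore] -/
theorem compress_X (k : ℕ) : (T.compress n₀ gap htriv).X k = T.X (cidx n₀ gap k) := rfl

/-- Unfolding: the centres of the compressed tower. [folklore] -/
theorem compress_C (k : ℕ) : (T.compress n₀ gap htriv).C k = T.C (cidx n₀ gap k) := rfl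

/-- Unfolding: the blow-downs of the compressed tower. [folklore] -/
theorem compress_π (k : ℕ) :
    (T.compress n₀ gap htriv).π k = T.hop (cidx n₀ gap k) (gap k) ≫ T.π (cidx n₀ gap k) := rfl

/-- Unfolding: the centre ideals of the compressed tower. [folklore] -/
theorem centreIdeal_compress (k : ℕ) : (T.compress n₀ gap htriv).centreIdeal k = T.centreIdeal (cidx n₀ gap k) := rfl

/-- `H^N` at a point of a kept stage is read on `T`. [folklore] -/
theorem hsFun_compress (N k : ℕ) (y : (T.compress n₀ gap htriv).X k) :
    Scheme.hsFun ((T.compress n₀ gap htriv).X k) N y = Scheme.hsFun (T.X (cidx n₀ gap k)) N y := rfl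

/-- `e` at a point of a kept stage is read on `T`. [folklore] -/
theorem dirDimAt_compress (k : ℕ) (y : (T.compress n₀ gap htriv).X k) :
    (T.compress n₀ gap htriv).dirDimAt k y = T.dirDimAt (cidx n₀ gap k) y := rfl

/-- `ē` at a point of a kept stage is read on `T`. [folklore] -/
theorem geomDirDimAt_compress (k : ℕ) (y : (T.compress n₀ gap htriv).X k) :
    (T.compress n₀ gap htriv).geomDirDimAt k y = T.geomDirDimAt (cidx n₀ gap k) y := rfl

/-- **The structure maps of the compressed tower are `T`'s composites**: `φ'_k ≫ φ_{n₀} = φ_{cidx k}` (as maps to `X_0`).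
[folklore] -/
theorem compress_phi_comp_phi : ∀ k : ℕ, (T.compress n₀ gap htriv).phi k ≫ T.phi n₀ = T.phi (cidx n₀ gap k)
  | 0 => Category.id_comp _
  | k + 1 => by
    have ih := compress_phi_comp_phi k
    calc (T.compress n₀ gap htriv).phi (k + 1) ≫ T.phi n₀
        = (T.hop (cidx n₀ gap k) (gap k) ≫ T.π (cidx n₀ gap k)) ≫ ((T.compress n₀ gap htriv).phi k ≫ T.phi n₀) :=
          (Category.assoc _ _ _)
      _ = (T.hop (cidx n₀ gap k) (gap k) ≫ T.π (cidx n₀ gap k)) ≫ T.phi (cidx n₀ gap k) := by rw [ih]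
      _ = T.hop (cidx n₀ gap k) (gap k) ≫ T.phi (cidx n₀ gap k + 1) := Category.assoc _ _ _
      _ = T.phi (cidx n₀ gap k + gap k + 1) := T.hop_comp_phi (cidx n₀ gap k) (gap k)

/-- Pointwise form: `φ_{n₀}(φ'_k(y)) = φ_{cidx k}(y)`. [folklore] -/
theorem phi_base_compress_phi (k : ℕ) (y : (T.compress n₀ gap htriv).X k) :
    (T.phi n₀).base (((T.compress n₀ gap htriv).phi k).base y) = (T.phi (cidx n₀ gap k)).base y := by
  rw [← T.compress_phi_comp_phi htriv k]; rfl

/-- When the compression starts at stage `0`, the structure maps agree: `φ'_k = φ_{cidx k}`. [folklore] -/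
theorem compress_phi_zero {gap : ℕ → ℕ} (htriv : ∀ k j, j < gap k → T.C (cidx 0 gap k + j + 1) = ∅) (k : ℕ) :
    (T.compress 0 gap htriv).phi k = T.phi (cidx 0 gap k) := by
  have h := T.compress_phi_comp_phi htriv k
  have h0 : T.phi 0 = 𝟙 (T.X 0) := rfl
  rw [h0] at h
  exact (Category.comp_id _).symm.trans h

/-- **Near loci of the compressed tower** (compression from stage `0`): `T'.nearLocus N x k = T.nearLocus N x (cidx k)`.
[cite: CossartJannsenSaito2020, Def. 6.34 (ii)] -/
theorem nearLocus_compress_zero {gap : ℕ → ℕ} (htriv : ∀ k j, j < gap k → T.C (cidx 0 gap k + j + 1) = ∅) (N : ℕ)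
    (x : T.X 0) (k : ℕ) : (T.compress 0 gap htriv).nearLocus N x k = T.nearLocus N x (cidx 0 gap k) := by
  ext y
  simp only [nearLocus, Set.mem_setOf_eq, T.compress_phi_zero htriv k]
  rfl

end BlowupTower

end Literature.AlgebraicGeometry.CossartJannsenSaito2020

end
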